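import Summits.AtomisticToContinuum.BoseEinsteinCondensation.Theorems.BECProbeMassFlowRecoilTransferCompleteCondensation
import HarnessLib

/-!
# Route `BECProbeMassFlow`, crux `RecoilTransfer` (stmt-AtomisticToContinuum-12311):
# complete condensation closes the conjunct WITHOUT the route's two XL cruxes

Support file for the crux `RecoilTransfer`, line `registered` (lead c4). The statement-level sandwich of
`BECProbeMassFlowRecoilTransferCompleteCondensation.lean` (lead c3, p163242) says that, GIVEN the sibling crux
`CloudMomentumAtom`, the crux `RecoilTransfer` is EQUIVALENT to complete condensation of the dilute periodic gas
(`recoilTransfer_iff_completeCondensation_of_cloudMomentumAtom`; complete condensation written inline, canonical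
shape: `N` bosons, torus of side `sideLength ρ N`, every `ε > 0`, small `ρ`, eventually in `N`, some slack `δ`).
This file records the other half of the picture, so that the whole calibration of the route is in the tree:

* `periodicBEC_of_completeCondensation` — complete condensation gives, for each admissible `v`, the
  `PeriodicBEC` body with `c = 1/2` (the hypothesis of the shared crux `BoundaryTransferWeak`), by `ε := 1/2`;
* `boseEinsteinCondensation_of_completeCondensation` — hence complete condensation and `BoundaryTransferWeak`
  ALONE close the conjunct `BoseEinsteinCondensation`: neither `CloudMomentumAtom` nor `RecoilTransfer` is needed;
* `recoilTransfer_and_cloudMomentumAtom_iff` — and the route's two XL cruxes together say exactly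
  "`CloudMomentumAtom` and complete condensation".

Reading (for the planners, D-0014): the route `CloudMomentumAtom → RecoilTransfer → StaticFloorCondenses →
BoundaryTransferWeak → BoseEinsteinCondensation` factors through complete condensation, which is at least the
conjunct (modulo the shared boundary-condition crux) and does not use the static floor; the crux `RecoilTransfer`
is therefore not a piece short of the summit but the summit's strong form wearing the static floor as an idle
hypothesis. Pure logic; no analysis; no definition (the open statement stays inline).
-/

noncomputable section

open MeasureTheory Filter
open scoped ENNReal NNReal

namespace Summit.AtomisticToContinuum.BoseEinsteinCondensation.Theorems

open Literature.MathematicalPhysics.QuantumManyBody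
open Literature.MathematicalPhysics.QuantumManyBody.BoseGas
open Summit.AtomisticToContinuum.BoseEinsteinCondensation.Theses.BECProbeMassFlow

/-- **Complete condensation gives the `PeriodicBEC` body (`c = 1/2`) for every admissible `v`.** If for every
repulsive finite-range `v` and every `ε > 0` there is `ρ₀ > 0` such that for `0 < ρ < ρ₀`, eventually in `N`, some
`δ > 0` makes every `δ`-near-minimiser `Ψ` of the periodic `N`-boson energy on the torus of side `(N/ρ)^{1/3}`
satisfy `n₀(Ψ) ≥ (1 - ε)N`, then (take `ε = 1/2`) for every such `v` there is `ρ₀ > 0` such that for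
`0 < ρ < ρ₀` some `c > 0` (namely `1/2`) has, eventually in `N`, `ofReal (c·N) ≤ n₀(Ψ)` on the `δ`-near-minimisers —
verbatim the hypothesis of `BoundaryTransferWeak` at `v`. [folklore] -/
theorem periodicBEC_of_completeCondensation
    (h : ∀ v : ℝ → ℝ≥0∞, IsRepulsiveFiniteRange v → ∀ ε : ℝ, 0 < ε → ∃ ρ₀ : ℝ, 0 < ρ₀ ∧ ∀ ρ : ℝ, 0 < ρ → ρ < ρ₀ →
      ∀ᶠ N : ℕ in Filter.atTop, ∃ δ : ℝ≥0∞, 0 < δ ∧ ∀ Ψ : PeriodicTrialState N (sideLength ρ N),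
        periodicEnergy v Ψ ≤ periodicGroundStateEnergy v N (sideLength ρ N) + δ →
          ENNReal.ofReal ((1 - ε) * N) ≤ condensateOccupation N (sideLength ρ N) Ψ.ψ)
    (v : ℝ → ℝ≥0∞) (hv : IsRepulsiveFiniteRange v) :
    ∃ ρ₀ : ℝ, 0 < ρ₀ ∧ ∀ ρ : ℝ, 0 < ρ → ρ < ρ₀ → ∃ c : ℝ, 0 < c ∧ ∀ᶠ N : ℕ in Filter.atTop,
      ∃ δ : ℝ≥0∞, 0 < δ ∧ ∀ Ψ : PeriodicTrialState N (sideLength ρ N),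
        periodicEnergy v Ψ ≤ periodicGroundStateEnergy v N (sideLength ρ N) + δ →
          ENNReal.ofReal (c * N) ≤ condensateOccupation N (sideLength ρ N) Ψ.ψ := by
  obtain ⟨ρ₀, hρ₀, H⟩ := h v hv (1 / 2) (by norm_num)
  refine ⟨ρ₀, hρ₀, fun ρ hρ hρlt => ⟨1 / 2, by norm_num, ?_⟩⟩
  filter_upwards [H ρ hρ hρlt] with N hN
  obtain ⟨δ, hδ, hocc⟩ := hN
  refine ⟨δ, hδ, fun Ψ hΨ => ?_⟩
  have h12 : ((1 : ℝ) - 1 / 2) = 1 / 2 := by norm_num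
  simpa only [h12] using hocc Ψ hΨ

/-- **Complete condensation and `BoundaryTransferWeak` close the conjunct — the route's two XL cruxes are not
needed.** With complete condensation of the dilute periodic gas (inline hypothesis, canonical shape) and the
shared mode-free boundary-condition transfer `BoundaryTransferWeak` (stmt-AtomisticToContinuum-0827), the
sub-problem statement `BoseEinsteinCondensation` (`HasGroundStateBEC v ρ` for all small `ρ`, every repulsive
finite-range `v`) follows: feed `periodicBEC_of_completeCondensation` to the transfer. Compare the route's
`closes : CloudMomentumAtom → RecoilTransfer → StaticFloorCondenses → BoundaryTransferWeak → BoseEinsteinCondensation`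
and `completeCondensation_of_cloudMomentumAtom : CloudMomentumAtom → RecoilTransfer → (complete condensation)`:
the route factors through this theorem. [folklore] -/
theorem boseEinsteinCondensation_of_completeCondensation :
    (∀ v : ℝ → ℝ≥0∞, IsRepulsiveFiniteRange v → ∀ ε : ℝ, 0 < ε → ∃ ρ₀ : ℝ, 0 < ρ₀ ∧ ∀ ρ : ℝ, 0 < ρ → ρ < ρ₀ →
      ∀ᶠ N : ℕ in Filter.atTop, ∃ δ : ℝ≥0∞, 0 < δ ∧ ∀ Ψ : PeriodicTrialState N (sideLength ρ N),
        periodicEnergy v Ψ ≤ periodicGroundStateEnergy v N (sideLength ρ N) + δ →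
          ENNReal.ofReal ((1 - ε) * N) ≤ condensateOccupation N (sideLength ρ N) Ψ.ψ) →
      Summit.AtomisticToContinuum.BoseEinsteinCondensation.Theses.BECProbeMassFlow.BoundaryTransferWeak →
        _root_.BoseEinsteinCondensation :=
  fun h h4 v hv => h4 v hv (periodicBEC_of_completeCondensation h v hv)

/-- **What the route's two XL cruxes jointly assert**: `CloudMomentumAtom ∧ RecoilTransfer` holds iff
`CloudMomentumAtom` holds and the dilute periodic gas condenses completely (inline). (`→`: the landed
`completeCondensation_of_cloudMomentumAtom`; `←`: the landed `recoilTransfer_of_completeCondensation`, in which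
the static floor is idle.) Together with `boseEinsteinCondensation_of_completeCondensation` this is the full
calibration of route `BECProbeMassFlow` against the open problem of the conjunct. [folklore] -/
theorem recoilTransfer_and_cloudMomentumAtom_iff :
    (CloudMomentumAtom ∧ RecoilTransfer) ↔
      (CloudMomentumAtom ∧
        ∀ v : ℝ → ℝ≥0∞, IsRepulsiveFiniteRange v → ∀ ε : ℝ, 0 < ε → ∃ ρ₀ : ℝ, 0 < ρ₀ ∧ ∀ ρ : ℝ, 0 < ρ → ρ < ρ₀ →
          ∀ᶠ N : ℕ in Filter.atTop, ∃ δ : ℝ≥0∞, 0 < δ ∧ ∀ Ψ : PeriodicTrialState N (sideLength ρ N),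
            periodicEnergy v Ψ ≤ periodicGroundStateEnergy v N (sideLength ρ N) + δ →
              ENNReal.ofReal ((1 - ε) * N) ≤ condensateOccupation N (sideLength ρ N) Ψ.ψ) :=
  ⟨fun h => ⟨h.1, completeCondensation_of_cloudMomentumAtom h.1 h.2⟩,
    fun h => ⟨h.1, recoilTransfer_of_completeCondensation h.2⟩⟩

/-! ### The open stub of line `registered`, calibrated -/

/-- **The one open stub of the line implies complete condensation, given the sibling crux.** The body of the
registered stub `stub_massFlowZeroMomentum` (mass flow `κ₀ → 1` on the zero-momentum sector; hypothesis written
verbatim) gives the crux through the landed reduction `recoilTransfer_of_massFlowZeroMomentum` (p161235), hence,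
with `CloudMomentumAtom`, complete condensation of the dilute periodic gas (`completeCondensation_of_cloudMomentumAtom`).
So the stub is, modulo the route's other crux, AT LEAST the open problem of the conjunct in its strong form; the
converse (`complete condensation → stub`) is not claimed: it needs simplicity of the bottom of the `(N+1)`-body
Hamiltonian in the TAGGED (bath-symmetric-only) sector, which the tree's Bose-sector Perron–Frobenius stack does not
state. [folklore] -/
theorem completeCondensation_of_massFlowZeroMomentum :
    (∀ v : ℝ → ℝ≥0∞, IsRepulsiveFiniteRange v → ∀ ε : ℝ, 0 < ε →
      ∃ ρ₀ : ℝ, 0 < ρ₀ ∧ ∀ ρ : ℝ, 0 < ρ → ρ < ρ₀ → ∀ᶠ N : ℕ in Filter.atTop,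
        ∀ a : ℝ, ∀ κ₀ : ℝ, 0 < κ₀ → κ₀ ≤ 1 →
          (∀ κ : ℝ, 0 < κ → κ ≤ κ₀ → ∃ δ : ℝ≥0∞, 0 < δ ∧
            ∀ Ψ : TaggedPeriodicTrialState N (sideLength ρ (N + 1)), HasTotalMomentum 0 Ψ.ψ →
              taggedPeriodicEnergy v κ Ψ ≤
                  taggedPeriodicGroundStateEnergy v κ N (sideLength ρ (N + 1)) + δ →
                ENNReal.ofReal a ≤ taggedZeroModeOccupation N (sideLength ρ (N + 1)) Ψ.ψ) →
          ∃ δ' : ℝ≥0∞, 0 < δ' ∧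
            ∀ Ψ : TaggedPeriodicTrialState N (sideLength ρ (N + 1)), HasTotalMomentum 0 Ψ.ψ →
              taggedPeriodicEnergy v 1 Ψ ≤
                  taggedPeriodicGroundStateEnergy v 1 N (sideLength ρ (N + 1)) + δ' →
                ENNReal.ofReal (a - ε) ≤ taggedZeroModeOccupation N (sideLength ρ (N + 1)) Ψ.ψ) →
    Summit.AtomisticToContinuum.BoseEinsteinCondensation.Theses.BECProbeMassFlow.CloudMomentumAtom →
    ∀ v : ℝ → ℝ≥0∞, IsRepulsiveFiniteRange v → ∀ ε : ℝ, 0 < ε → ∃ ρ₀ : ℝ, 0 < ρ₀ ∧ ∀ ρ : ℝ, 0 < ρ → ρ < ρ₀ →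
      ∀ᶠ N : ℕ in Filter.atTop, ∃ δ : ℝ≥0∞, 0 < δ ∧ ∀ Ψ : PeriodicTrialState N (sideLength ρ N),
        periodicEnergy v Ψ ≤ periodicGroundStateEnergy v N (sideLength ρ N) + δ →
          ENNReal.ofReal ((1 - ε) * N) ≤ condensateOccupation N (sideLength ρ N) Ψ.ψ :=
  fun hflow h1 => completeCondensation_of_cloudMomentumAtom h1 (recoilTransfer_of_massFlowZeroMomentum hflow)

end Summit.AtomisticToContinuum.BoseEinsteinCondensation.Theorems

end
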